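import Summits.KontsevichZagierPeriods.Zeta5Search.Denom.WindowModP

/-!
# Harmonic sums over integer intervals, exactly and modulo `p` (fam-denom, THEOREM W toolkit)

HONEST FRAMING: systematic search; no irrationality claim unless certified.  Cell `pub-zeta5`,
DENOMINATOR ARITHMETIC lane (`families/denom/P15KERNEL.md` §10.9).  Pure bookkeeping of rational
numbers; nothing about irrationality.

With `H(m) = Σ_{d=1}^{m} 1/d` (`HI m`, integer-indexed, `0` for `m ≤ 0`) and
`Hodd(m) = Σ_{i=0}^{m−1} 1/(2i+1)` (`HoddI m`):
* exact identities: `harmAlt1 (2u) = Hodd(u) − H(u)/2` for the finite alternating sum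
  `harmAlt1 m = Σ_{ℓ=1}^{m} (−1)^{ℓ−1}/ℓ` of [Zudilin 2014, §6]; `H(2m) = Hodd(m) + H(m)/2`;
  evaluations of `Σ_k 1/(j − k)` over an integer interval (with or without the point `k = j`
  removed) as differences of `H`; affine re-indexing and reflection of interval sums;
* congruences for an odd prime `p = 2h + 1` (`EqModP` of `WindowModP`): `Hodd(u) ≡ (H(u+h) − H(h))/2`
  (`u ≤ h`), the reflection `H(2h − r) ≡ H(r)` (`r ≤ 2h`; in particular `H(p−1) ≡ 0`), and the two
  weight evaluations of THEOREM W: `harmAlt1 (2u) ≡ (H(h−u) − H(h) − H(u))/2` for `u ≤ h`, and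
  `harmAlt1 (2u) − 1/p ≡ (H(u−h−1) − H(h) − H(u))/2` for `h < u ≤ 2h`.
-/

noncomputable section

namespace Summit.KontsevichZagierPeriods.Zeta5Search.Denom.WindowHarmonic

open Finset
open Literature.NumberTheory.Irrationality.Zudilin2014 (harmAlt1)
open Summit.KontsevichZagierPeriods.Zeta5Search.Denom.WindowModP

/-! ### Harmonic sums over integer intervals: exact identities -/

section Harmonic

/-- `H(m) = Σ_{d=1}^{m} 1/d` (integer-indexed harmonic number; `0` for `m ≤ 0`). -/
def HI (m : ℤ) : ℚ := ∑ d ∈ Ico (1 : ℤ) (m + 1), 1 / (d : ℚ)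

/-- `Hodd(m) = Σ_{i=0}^{m−1} 1/(2i+1)` (`0` for `m ≤ 0`). -/
def HoddI (m : ℤ) : ℚ := ∑ i ∈ Ico (0 : ℤ) m, 1 / (2 * (i : ℚ) + 1)

/-- `H(m) = 0` for `m ≤ 0`. -/
theorem HI_of_nonpos {m : ℤ} (hm : m ≤ 0) : HI m = 0 := by
  unfold HI; rw [Finset.Ico_eq_empty (by omega), sum_empty]

/-- `H(0) = 0`. -/
@[simp] theorem HI_zero : HI 0 = 0 := HI_of_nonpos le_rfl

/-- `Hodd(0) = 0`. -/
@[simp] theorem HoddI_zero : HoddI 0 = 0 := by unfold HoddI; simp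

/-- `H(m+1) = H(m) + 1/(m+1)` for `m ≥ 0`. -/
theorem HI_succ {m : ℤ} (hm : 0 ≤ m) : HI (m + 1) = HI m + 1 / ((m : ℚ) + 1) := by
  unfold HI
  have e : Ico (1 : ℤ) (m + 1 + 1) = insert (m + 1) (Ico 1 (m + 1)) := by
    ext x; simp only [mem_Ico, mem_insert]; omega
  rw [e, sum_insert (by simp), add_comm]; push_cast; rfl

/-- `Hodd(m+1) = Hodd(m) + 1/(2m+1)` for `m ≥ 0`. -/
theorem HoddI_succ {m : ℤ} (hm : 0 ≤ m) : HoddI (m + 1) = HoddI m + 1 / (2 * (m : ℚ) + 1) := by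
  unfold HoddI
  have e : Ico (0 : ℤ) (m + 1) = insert m (Ico 0 m) := by
    ext x; simp only [mem_Ico, mem_insert]; omega
  rw [e, sum_insert (by simp), add_comm]

/-- Splitting a sum over an integer interval `Ico a c` at `b`. -/
theorem sum_Ico_split (f : ℤ → ℚ) {a b c : ℤ} (hab : a ≤ b) (hbc : b ≤ c) :
    ∑ x ∈ Ico a c, f x = ∑ x ∈ Ico a b, f x + ∑ x ∈ Ico b c, f x := by
  rw [← sum_union (Ico_disjoint_Ico_consecutive a b c), Ico_union_Ico_eq_Ico hab hbc]

/-- Affine re-indexing `x ↦ x + c` of a sum over an integer interval. -/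
theorem sum_Ico_shift (f : ℤ → ℚ) (a b c : ℤ) :
    ∑ x ∈ Ico (a + c) (b + c), f x = ∑ x ∈ Ico a b, f (x + c) := by
  refine sum_nbij' (fun x => x - c) (fun x => x + c) ?_ ?_ ?_ ?_ ?_
  · intro x hx; simp only [mem_Ico] at hx ⊢; omega
  · intro x hx; simp only [mem_Ico] at hx ⊢; omega
  · intro x _; ring
  · intro x _; ring
  · intro x _; congr 1; ring

/-- Reflection `x ↦ c − x` of a sum over an integer interval. -/
theorem sum_Ico_reflect' (f : ℤ → ℚ) (a b c : ℤ) :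
    ∑ x ∈ Ico a b, f x = ∑ x ∈ Ico (c + 1 - b) (c + 1 - a), f (c - x) := by
  refine sum_nbij' (fun x => c - x) (fun x => c - x) ?_ ?_ ?_ ?_ ?_
  · intro x hx; simp only [mem_Ico] at hx ⊢; omega
  · intro x hx; simp only [mem_Ico] at hx ⊢; omega
  · intro x _; ring
  · intro x _; ring
  · intro x _; congr 1; ring

/-- `H(b) − H(a) = Σ_{d=a+1}^{b} 1/d` for `0 ≤ a ≤ b`. -/
theorem HI_sub_HI {a b : ℤ} (ha : 0 ≤ a) (hab : a ≤ b) :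
    HI b - HI a = ∑ d ∈ Ico (a + 1) (b + 1), 1 / (d : ℚ) := by
  unfold HI
  rw [sum_Ico_split (fun d : ℤ => 1 / (d : ℚ)) (b := a + 1) (by omega) (by omega)]
  ring

/-- `harmAlt1 (2u) = Hodd(u) − H(u)/2`: the finite alternating harmonic sum split by parity. -/
theorem harmAlt1_two_mul (u : ℕ) : harmAlt1 (2 * u) = HoddI u - HI u / 2 := by
  induction u with
  | zero => simp [harmAlt1]
  | succ u ih =>
    have e : 2 * (u + 1) = 2 * u + 1 + 1 := by ring
    rw [e]
    unfold harmAlt1 at ih ⊢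
    rw [sum_range_succ, sum_range_succ, ih]
    have h1 : (-1 : ℚ) ^ (2 * u) = 1 := by rw [pow_mul]; simp
    have h2 : (-1 : ℚ) ^ (2 * u + 1) = -1 := by rw [pow_succ, h1]; simp
    rw [h1, h2]
    push_cast
    rw [HoddI_succ (by positivity), HI_succ (by positivity)]
    push_cast
    have hu1 : (2 * (u : ℚ) + 1) ≠ 0 := by positivity
    have hu2 : ((u : ℚ) + 1) ≠ 0 := by positivity
    have hu3 : (2 * (u : ℚ) + 1 + 1) ≠ 0 := by positivity
    field_simp
    ring

/-- `H(2m) = Hodd(m) + H(m)/2`. -/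
theorem HI_two_mul (m : ℕ) : HI (2 * m) = HoddI m + HI m / 2 := by
  induction m with
  | zero => simp
  | succ m ih =>
    have e : (2 * (m + 1 : ℕ) : ℤ) = 2 * m + 1 + 1 := by push_cast; ring
    rw [e, HI_succ (by positivity), HI_succ (by positivity), ih]
    push_cast
    rw [HoddI_succ (by positivity), HI_succ (by positivity)]
    push_cast
    have hu1 : (2 * (m : ℚ) + 1) ≠ 0 := by positivity
    have hu2 : ((m : ℚ) + 1) ≠ 0 := by positivity
    have hu3 : (2 * (m : ℚ) + 1 + 1) ≠ 0 := by positivity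
    field_simp
    ring

/-- For `j < A ≤ B + 1`: `Σ_{k=A}^{B} 1/(j − k) = H(A − 1 − j) − H(B − j)`. -/
theorem sum_inv_sub_of_lt {j A B : ℤ} (hjA : j < A) (hAB : A ≤ B + 1) :
    ∑ k ∈ Ico A (B + 1), 1 / ((j : ℚ) - k) = HI (A - 1 - j) - HI (B - j) := by
  have h := HI_sub_HI (a := A - 1 - j) (b := B - j) (by omega) (by omega)
  have e : ∑ k ∈ Ico A (B + 1), 1 / ((j : ℚ) - k)
      = -∑ d ∈ Ico (A - 1 - j + 1) (B - j + 1), 1 / (d : ℚ) := by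
    have := sum_Ico_shift (fun k : ℤ => 1 / ((j : ℚ) - k)) (A - 1 - j + 1) (B - j + 1) j
    have e1 : A - 1 - j + 1 + j = A := by ring
    have e2 : B - j + 1 + j = B + 1 := by ring
    rw [e1, e2] at this
    rw [this, ← sum_neg_distrib]
    refine sum_congr rfl fun d _ => ?_
    push_cast
    rw [show (j : ℚ) - (d + j) = -(d : ℚ) by ring, div_neg]
  rw [e, ← h]; ring


/-- For `A ≤ j ≤ B`: `Σ_{k=A, k≠j}^{B} 1/(j − k) = H(j − A) − H(B − j)`. -/
theorem sum_inv_sub_erase {j A B : ℤ} (hAj : A ≤ j) (hjB : j ≤ B) :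
    ∑ k ∈ (Ico A (B + 1)).erase j, 1 / ((j : ℚ) - k) = HI (j - A) - HI (B - j) := by
  have e : (Ico A (B + 1)).erase j = Ico A j ∪ Ico (j + 1) (B + 1) := by
    ext x; simp only [mem_erase, mem_Ico, mem_union]; omega
  have hd : Disjoint (Ico A j) (Ico (j + 1) (B + 1)) := by
    rw [disjoint_left]; intro x hx hx'; simp only [mem_Ico] at hx hx'; omega
  rw [e, sum_union hd]
  have h1 : ∑ k ∈ Ico A j, 1 / ((j : ℚ) - k) = HI (j - A) := by
    unfold HI
    rw [sum_Ico_reflect' (fun k : ℤ => 1 / ((j : ℚ) - k)) A j j]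
    have e1 : j + 1 - j = 1 := by ring
    have e2 : j + 1 - A = j - A + 1 := by ring
    rw [e1, e2]
    refine sum_congr rfl fun d _ => ?_
    push_cast; congr 1; ring
  have h2 : ∑ k ∈ Ico (j + 1) (B + 1), 1 / ((j : ℚ) - k) = -HI (B - j) := by
    unfold HI
    have := sum_Ico_shift (fun k : ℤ => 1 / ((j : ℚ) - k)) 1 (B - j + 1) j
    have e1 : (1 : ℤ) + j = j + 1 := by ring
    have e2 : B - j + 1 + j = B + 1 := by ring
    rw [e1, e2] at this
    rw [this, ← sum_neg_distrib]
    refine sum_congr rfl fun d _ => ?_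
    push_cast
    rw [show (j : ℚ) - (d + j) = -(d : ℚ) by ring, div_neg]
  rw [h1, h2]; ring

/-- For `c₀ ≤ α ≤ j + 1`: `H(j + 1 − α) − H(j + 1 − c₀) = −Σ_{c=c₀}^{α−1} 1/(j + 1 − c)`. -/
theorem HI_sub_eq_neg_sum {j α c₀ : ℤ} (hc : c₀ ≤ α) (hα : α ≤ j + 1) :
    HI (j + 1 - α) - HI (j + 1 - c₀) = -∑ c ∈ Ico c₀ α, 1 / ((j : ℚ) + 1 - c) := by
  have h := HI_sub_HI (a := j + 1 - α) (b := j + 1 - c₀) (by omega) (by omega)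
  rw [← neg_sub, h, sum_Ico_reflect' (fun d : ℤ => 1 / (d : ℚ)) (j + 1 - α + 1) (j + 1 - c₀ + 1)
    (j + 1)]
  have e1 : j + 1 + 1 - (j + 1 - c₀ + 1) = c₀ := by ring
  have e2 : j + 1 + 1 - (j + 1 - α + 1) = α := by ring
  rw [e1, e2]
  congr 1
  refine sum_congr rfl fun c _ => ?_
  push_cast; ring

/-- Variant: for `c₀ ≤ α ≤ j`, `H(j − α) − H(j − c₀) = −Σ_{c=c₀}^{α−1} 1/(j − c)`. -/
theorem HI_sub_eq_neg_sum' {j α c₀ : ℤ} (hc : c₀ ≤ α) (hα : α ≤ j) :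
    HI (j - α) - HI (j - c₀) = -∑ c ∈ Ico c₀ α, 1 / ((j : ℚ) - c) := by
  have h := HI_sub_eq_neg_sum (j := j - 1) (α := α) (c₀ := c₀) hc (by omega)
  have e1 : j - 1 + 1 - α = j - α := by ring
  have e2 : j - 1 + 1 - c₀ = j - c₀ := by ring
  rw [e1, e2] at h
  rw [h]; congr 1
  refine sum_congr rfl fun c _ => ?_
  push_cast; ring

end Harmonic

/-! ### Congruences for an odd prime `p = 2h + 1` -/

section OddPrime

variable {p : ℕ} [hp : Fact p.Prime] {h : ℕ}

/-- `‖2‖_p = 1` for odd `p` (file-local copy; the public statement is the tree's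
`SecondOrder.padicNorm_two` — kept private here to avoid a `dedup.landed` twin; lane edit lead/lit g13). -/
private theorem padicNorm_two_eq_one (h2 : p ≠ 2) : padicNorm p (2 : ℚ) = 1 := by
  simpa using padicNorm.padicNorm_of_prime_of_ne (p := p) (q := 2) h2

/-- `Hodd(u) ≡ (H(u+h) − H(h))/2 (mod p)` for `u ≤ h`, `p = 2h+1`:
termwise `1/(2i+1) ≡ 1/(2i+1+p) = (1/2)·1/(i+h+1)`. -/
theorem HoddI_modP (hph : p = 2 * h + 1) {u : ℕ} (hu : u ≤ h) :
    EqModP p (HoddI u) ((HI (u + h) - HI h) / 2) := by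
  rw [HI_sub_HI (by positivity) (by omega)]
  have e : (∑ d ∈ Ico ((h : ℤ) + 1) (u + h + 1), 1 / (d : ℚ)) / 2
      = ∑ i ∈ Ico (0 : ℤ) u, 1 / ((p : ℚ) + ((2 * i + 1 : ℤ) : ℚ)) := by
    have := sum_Ico_shift (fun d : ℤ => 1 / (d : ℚ)) 0 u (h + 1)
    have e1 : (0 : ℤ) + (h + 1) = h + 1 := by ring
    have e2 : (u : ℤ) + (h + 1) = u + h + 1 := by ring
    rw [e1, e2] at this
    rw [this, sum_div]
    refine sum_congr rfl fun i hi => ?_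
    rw [mem_Ico] at hi
    have hi0 : (0 : ℚ) ≤ i := by exact_mod_cast hi.1
    have hne : ((i : ℚ) + ((h : ℚ) + 1)) ≠ 0 := ne_of_gt (by positivity)
    rw [hph]; push_cast
    rw [div_div]; congr 1; ring
  rw [e]
  unfold HoddI
  refine EqModP.sum fun i hi => ?_
  rw [mem_Ico] at hi
  have h1 := (inv_p_add_modP (p := p) (e := 2 * i + 1)
    (not_dvd_of_natAbs_lt (by omega) (by omega))).symm
  refine h1.congr ?_ rfl
  push_cast; rfl

/-- **Reflection**, case `r ≤ h`: `H(2h − r) ≡ H(r) (mod p)`, `p = 2h + 1`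
(pair `d ↔ p − d` on `r < d ≤ 2h − r`: `1/d + 1/(p−d) = p/(d(p−d))`). -/
theorem HI_reflect_modP_of_le (hph : p = 2 * h + 1) {r : ℕ} (hr : r ≤ h) :
    EqModP p (HI (2 * h - r)) (HI r) := by
  have h2 : p ≠ 2 := by omega
  unfold EqModP
  rw [HI_sub_HI (a := r) (b := 2 * h - r) (by positivity) (by omega)]
  have hrefl : ∑ d ∈ Ico ((r : ℤ) + 1) (2 * h - r + 1), 1 / (d : ℚ)
      = ∑ d ∈ Ico ((r : ℤ) + 1) (2 * h - r + 1), 1 / ((p : ℚ) - d) := by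
    rw [sum_Ico_reflect' (fun d : ℤ => 1 / (d : ℚ)) ((r : ℤ) + 1) (2 * h - r + 1) (2 * h + 1)]
    have ea : (2 * (h : ℤ) + 1 + 1 - (2 * h - r + 1)) = (r : ℤ) + 1 := by ring
    have eb : (2 * (h : ℤ) + 1 + 1 - (r + 1)) = 2 * h - r + 1 := by ring
    rw [ea, eb]
    refine sum_congr rfl fun d _ => ?_
    rw [hph]; push_cast; rfl
  have h2S : 2 * (∑ d ∈ Ico ((r : ℤ) + 1) (2 * h - r + 1), 1 / (d : ℚ))
      = ∑ d ∈ Ico ((r : ℤ) + 1) (2 * h - r + 1), (p : ℚ) / (d * ((p : ℚ) - d)) := by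
    rw [two_mul]
    nth_rw 2 [hrefl]
    rw [← sum_add_distrib]
    refine sum_congr rfl fun d hd => ?_
    rw [mem_Ico] at hd
    have hd0 : (d : ℚ) ≠ 0 := by exact_mod_cast (show d ≠ 0 by omega)
    have hpd' : (p : ℤ) - d ≠ 0 := by omega
    have hpd : ((p : ℚ) - d) ≠ 0 := by exact_mod_cast hpd'
    field_simp; ring
  have key : padicNorm p (2 * ∑ d ∈ Ico ((r : ℤ) + 1) (2 * h - r + 1), 1 / (d : ℚ)) ≤ (p : ℚ)⁻¹ := by
    rw [h2S]
    refine padicNorm.sum_le' (fun d hd => ?_) (by positivity)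
    rw [mem_Ico] at hd
    have hd1 : ¬ (p : ℤ) ∣ d := not_dvd_of_natAbs_lt (by omega) (by omega)
    have hd2 : ¬ (p : ℤ) ∣ (p : ℤ) - d := by
      intro hdd; exact hd1 (by simpa using dvd_sub (dvd_refl (p : ℤ)) hdd)
    rw [padicNorm.div, padicNorm.padicNorm_p_of_prime, padicNorm.mul]
    have e1 : padicNorm p (d : ℚ) = 1 := (padicNorm.int_eq_one_iff _).2 hd1
    have e2 : padicNorm p ((p : ℚ) - d) = 1 := by
      have := (padicNorm.int_eq_one_iff (p := p) ((p : ℤ) - d)).2 hd2; push_cast at this; exact this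
    rw [e1, e2, mul_one, div_one]
  rwa [padicNorm.mul, padicNorm_two_eq_one h2, one_mul] at key

/-- **Reflection** for all `r ≤ 2h`: `H(2h − r) ≡ H(r) (mod p)`, `p = 2h + 1`. -/
theorem HI_reflect_modP (hph : p = 2 * h + 1) {r : ℕ} (hr : r ≤ 2 * h) :
    EqModP p (HI (2 * h - r)) (HI r) := by
  by_cases hrh : r ≤ h
  · exact HI_reflect_modP_of_le hph hrh
  · have h1 := HI_reflect_modP_of_le hph (r := 2 * h - r) (by omega)
    have e2 : (((2 * h - r : ℕ) : ℤ)) = 2 * (h : ℤ) - r := by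
      rw [Nat.cast_sub hr]; push_cast; ring
    rw [e2] at h1
    have e1 : 2 * (h : ℤ) - (2 * (h : ℤ) - r) = r := by ring
    rw [e1] at h1
    exact h1.symm

/-- `H(p − 1) = H(2h) ≡ 0 (mod p)` (`p = 2h + 1`; from the reflection at `r = 0`). -/
theorem HI_two_mul_h_modP (hph : p = 2 * h + 1) : EqModP p (HI (2 * h)) 0 := by
  have := HI_reflect_modP_of_le hph (r := 0) (Nat.zero_le _)
  simpa using this

/-- `Hodd(h) ≡ −H(h)/2 (mod p)` (`p = 2h + 1`). -/
theorem HoddI_h_modP (hph : p = 2 * h + 1) : EqModP p (HoddI h) (-(HI h / 2)) := by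
  have e : HoddI h = HI (2 * h) - HI h / 2 := by rw [HI_two_mul]; ring
  rw [e]
  have := (HI_two_mul_h_modP hph).sub (EqModP.refl (p := p) (HI h / 2))
  simpa using this

/-- **Weight evaluation below the top**: for `u ≤ h` (`p = 2h + 1`),
`harmAlt1 (2u) ≡ (H(h − u) − H(h) − H(u))/2 (mod p)`. -/
theorem harmAlt1_modP_of_le (hph : p = 2 * h + 1) {u : ℕ} (hu : u ≤ h) :
    EqModP p (harmAlt1 (2 * u)) ((HI (h - u) - HI h - HI u) / 2) := by
  have h2 : p ≠ 2 := by omega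
  rw [harmAlt1_two_mul]
  have h1 := HoddI_modP hph hu
  have hr := HI_reflect_modP hph (r := h - u) (by omega)
  have e2 : ((h - u : ℕ) : ℤ) = (h : ℤ) - u := by rw [Nat.cast_sub hu]
  rw [e2] at hr
  have e1 : 2 * (h : ℤ) - ((h : ℤ) - u) = u + h := by ring
  rw [e1] at hr
  have h3 : EqModP p ((HI (u + h) - HI h) / 2) ((HI (h - u) - HI h) / 2) :=
    (hr.sub (EqModP.refl (p := p) (HI h))).div_two h2
  have h4 := (h1.trans h3).sub (EqModP.refl (p := p) (HI u / 2))
  refine h4.congr rfl ?_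
  ring

/-- **Weight evaluation in the top**: for `h < u ≤ 2h` (`p = 2h + 1`),
`harmAlt1 (2u) − 1/p ≡ (H(u − h − 1) − H(h) − H(u))/2 (mod p)`:
the `ℓ = p` term is removed; the odd terms beyond it are `1/(p + 2w) ≡ 1/(2w)`. -/
theorem harmAlt1_sub_modP_of_lt (hph : p = 2 * h + 1) {u : ℕ} (hhu : h < u) (hu : u ≤ 2 * h) :
    EqModP p (harmAlt1 (2 * u) - 1 / (p : ℚ)) ((HI (u - h - 1) - HI h - HI u) / 2) := by
  have h2 : p ≠ 2 := by omega
  rw [harmAlt1_two_mul]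
  -- split `Hodd(u)` at `h` and `h + 1`
  have hsplit : HoddI u = HoddI h + 1 / (p : ℚ)
      + ∑ i ∈ Ico ((h : ℤ) + 1) u, 1 / (2 * (i : ℚ) + 1) := by
    unfold HoddI
    rw [sum_Ico_split _ (a := (0 : ℤ)) (b := (h : ℤ)) (c := (u : ℤ)) (by positivity) (by omega),
      sum_Ico_split _ (a := (h : ℤ)) (b := (h : ℤ) + 1) (c := (u : ℤ)) (by omega) (by omega)]
    have e : Ico (h : ℤ) (h + 1) = {(h : ℤ)} := by
      ext x; simp only [mem_Ico, mem_singleton]; omega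
    rw [e, sum_singleton, hph]; push_cast; ring
  -- the block beyond `ℓ = p` is congruent to `H(u − h − 1)/2`
  have hmid : EqModP p (∑ i ∈ Ico ((h : ℤ) + 1) u, 1 / (2 * (i : ℚ) + 1))
      (HI (u - h - 1) / 2) := by
    have e : HI ((u : ℤ) - h - 1) / 2 = ∑ i ∈ Ico ((h : ℤ) + 1) u, 1 / (2 * ((i : ℚ) - h)) := by
      unfold HI
      have e0 : (u : ℤ) - h - 1 + 1 = u - h := by ring
      rw [e0, sum_div]
      have := sum_Ico_shift (fun i : ℤ => 1 / (2 * ((i : ℚ) - h))) 1 ((u : ℤ) - h) h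
      have e1 : (1 : ℤ) + h = h + 1 := by ring
      have e2 : (u : ℤ) - h + h = u := by ring
      rw [e1, e2] at this
      rw [this]
      refine sum_congr rfl fun w _ => ?_
      push_cast; rw [div_div]; congr 1; ring
    rw [e]
    refine EqModP.sum fun i hi => ?_
    rw [mem_Ico] at hi
    have h1 := inv_p_add_modP (p := p) (e := 2 * (i - h)) (not_dvd_two_mul h2 (by omega) (by omega))
    refine h1.congr ?_ ?_
    · rw [hph]; push_cast; congr 1; ring
    · push_cast; rfl
  rw [hsplit]
  have h3 := ((HoddI_h_modP hph).add (EqModP.refl (p := p) (1 / (p : ℚ)))).add hmid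
  have h4 := (h3.sub (EqModP.refl (p := p) (HI u / 2))).sub (EqModP.refl (p := p) (1 / (p : ℚ)))
  refine h4.congr rfl ?_
  ring

end OddPrime

end Summit.KontsevichZagierPeriods.Zeta5Search.Denom.WindowHarmonic
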